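import Summits.HodgeConjecture.HodgeConjecture.Theorems.Ring2AbelianAllAndreSquareTopPiece
import HarnessLib

/-!
# Ring 2 · sub-cell AbelianAll (ALL ABELIAN VARIETIES), André axis, part XXXVII-d — DEGREES OF `S`-ENDOMORPHISMS OF A COMPACT ABELIAN
# PENCIL, READ ON ONE FIBRE: `θ_* 1 = c · 1` when `θ_t^*` acts as `c` on the top class of `Y_t`; on the fibre square `θ_{1*} 1 = θ_{2*} 1 = N^{2d}`;
# hence PULL-BACK weights turn into PUSH-FORWARD weights (`θ^* D = Nᵘ D ⟹ θ_* D = N^{2d-u} D`)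

HONEST FRAMING (page 1, verbatim): **research route, not a corollary; conditional on HC_CM plus one named
minimal statement.** Cell line: research route conditional on HC_CM; not a corollary; Q11.4-sentence-2
already refuted in dim ≥ 3. Nothing in this file proves a case of the Hodge conjecture for an abelian variety; `HC_CM` does not occur in
this file; item `Theses.RankFourFaces.CMToAbelian` (stmt-16267) OPEN and not closed here. Seat `pub-hodge-ring2-ab-andre-2`, gen 29;
brief (iii). Part XXXVII derives the middle relative Lefschetz block (ρ) of ring2-b05's `B⋆(𝒳)` assembly from the fibre square by weights;
push-forward weights are what the selection rules of part XXXVII-e consume (`ν_* Γ_D = Γ_{θ_{1*} D}` is exact on the carriers, whereas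
pull-back base change holds only up to a scalar).

## What is proved (theorems only; no definition, no named fact, no sorry; `HC_CM` absent)

* `eq_smul_one_of_degree_zero` — `H⁰ = ℂ · 1` on a smooth projective variety.
* **`gysin_one_eq_smul_of_fibre_top`** (any compact pencil `g : 𝒵 ⟶ T` of abelian `n`-folds, any `S`-endomorphism `θ` with a restriction
  `θ_t` acting as `c` on `H^{2n}(Z_t)`): `θ_* 1 = c · 1` — pair with the top class `J_{t*} ω_t ≠ 0` (part XI), Gysin adjunction, the EXACT base
  change `θ^* J_{t*} = J_{t*} θ_t^*` of part XXXVII-b, Poincaré duality.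
* `smul_gysin_eq_of_map_eq_smul`, `smul_gysin_eq_smul_of_map_eq_smul`, **`gysin_eq_smul_of_map_eq_smul`** — projection formula:
  `θ^* D = Nᵘ D` and `θ_* 1 = Nʷ · 1` (`u ≤ w`) give `θ_* D = N^{w-u} D`.
* `map_whiskerRight_top'`, `map_whiskerLeft_top'` — `(φ × 1)^*`, `(1 × φ)^*` act as `N^{2 dim X}` on the top degree of `X × X` (the degree
  spelling `2 (m + m)` of the square pencil; part XXXVII-b).
* **`gysin_squareEndo_fst_one`, `gysin_squareEndo_snd_one`** — on the fibre square of a compact pencil of abelian `d`-folds with `ν` charted by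
  `[N]` on `X_t`: `θ_{1*} 1 = θ_{2*} 1 = N^{2d} · 1` (`θ_{1,t} = ν_t × 1`, part XXXVII-b's chart).

## Honest status

Per-pencil statements for a GIVEN fibrewise multiplication (θ∀ displayed); no node; nothing minimal; N104 untouched.

References: Fulton1998 (Thm. 6.2 (a), Example 1.7.4); FultonYoungTableaux1997 (App. B §B.1 (5)–(7)); HatcherAT2002 (§3.1, §3.2 Thm. 3.15, §3.3
Prop. 3.38); MumfordAV1970 (§19); Kleiman1968AlgebraicCycles (§1.3 p. 374); Kunnemann1993 (§2).
-/

noncomputable section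

set_option linter.dupNamespace false

namespace Summit.HodgeConjecture.HodgeConjecture.Ring2.AbelianAll

open CategoryTheory CategoryTheory.Limits AlgebraicGeometry MonoidalCategory CartesianMonoidalCategory
open Literature.AlgebraicGeometry Literature.AlgebraicGeometry.Motives
open Literature.AlgebraicGeometry.HodgeTheory
open Literature.AlgebraicTopology.SingularHomology (singularCohomology cupProduct cupProduct_map cupProduct_one one_cupProduct
  cupProduct_assoc cupProduct_gradedComm_holds cupPairing cupPairing_apply cupPairing_flip singularCohomologyZeroEquiv
  singularCohomologyZeroEquiv_one)
open Summit.HodgeConjecture.HodgeConjecture.Theorems (deg_fiberGysin_aux cupPairing_complexGysin_complexOrientationFamily)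

/-! ## §1 Degrees of `S`-endomorphisms -/

section Degrees

variable {𝒵 T : SchemeOver ℂ} {n : ℕ} {g : 𝒵 ⟶ T}

/-- **`H⁰ = ℂ · 1`** on a smooth projective variety: `u = ε(u) · 1` for the augmentation `ε`. [cite: HatcherAT2002, §3.1 p. 199] -/
theorem eq_smul_one_of_degree_zero {m : ℕ} (hZ : IsSmoothProjective m 𝒵) (u : complexBetti 𝒵 0) :
    ∃ c : ℂ, u = c • singularCohomology.one ℂ (ComplexPoints 𝒵) := by
  haveI := pathConnectedSpace_complexPoints hZ
  refine ⟨singularCohomologyZeroEquiv ℂ ℂ (ComplexPoints 𝒵) u, ?_⟩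
  apply (singularCohomologyZeroEquiv ℂ ℂ (ComplexPoints 𝒵)).injective
  rw [map_smul, singularCohomologyZeroEquiv_one, smul_eq_mul, mul_one]

/-- **THE DEGREE OF AN `S`-ENDOMORPHISM IS READ ON ONE FIBRE.** For a compact pencil `g : 𝒵 ⟶ T` of abelian `n`-folds, an
`S`-endomorphism `θ` with a restriction `θ_t` to `Z_t` acting on the top degree `H^{2n}(Z_t)` as the scalar `c`: `θ_* 1 = c · 1` in `H⁰(𝒵)`.
Proof: the top degree of `𝒵` is the line spanned by `ω = J_{t*} ω_t ≠ 0` (part XI); `⟨θ_* 1, ω⟩ = ⟨1, θ^* ω⟩` (Gysin adjunction),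
`θ^* J_{t*} ω_t = J_{t*} θ_t^* ω_t = c · ω` (part XXXVII-b's exact base change); `H⁰(𝒵) = ℂ · 1` and the Poincaré pairing is perfect.
[cite: Fulton1998, Thm. 6.2 (a) and Example 1.7.4] [cite: FultonYoungTableaux1997, Appendix B §B.1 (5)–(7)] [cite: HatcherAT2002, §3.3 Prop. 3.38] -/
theorem gysin_one_eq_smul_of_fibre_top (hg : IsCompactAbelianPencil g n) (t : ComplexPoints T) (θ : 𝒵 ⟶ 𝒵) (hθ : θ ≫ g = g)
    (θt : fiberOver g t ⟶ fiberOver g t) (hθt : θt ≫ fiberι g t = fiberι g t ≫ θ) (c : ℂ)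
    (htop : ∀ ω : complexBetti (fiberOver g t) (2 * n), complexBetti.map θt (2 * n) ω = c • ω) :
    complexGysin complexOrientationFamily hg.isSmoothProjective_total hg.isSmoothProjective_total θ
      (rfl : 0 + 2 * (n + 1) = 0 + 2 * (n + 1)) (singularCohomology.one ℂ (ComplexPoints 𝒵)) =
      c • singularCohomology.one ℂ (ComplexPoints 𝒵) := by
  have hZ := hg.isSmoothProjective_total
  obtain ⟨x, hx⟩ := exists_fiberGysin_map_fiberι_top_ne_zero hg t
  set ω : complexBetti 𝒵 (2 * (n + 1)) := fiberGysin hg t n (complexBetti.map (fiberι g t) (2 * n) x) with hω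
  -- `θ^* ω = c ω`
  have hθω : complexBetti.map θ (2 * (n + 1)) ω = c • ω := by
    change complexBetti.map θ (2 * (n + 1)) (complexGysin complexOrientationFamily (hg.isSmoothProjective_fiberOver t)
      hg.isSmoothProjective_total (fiberι g t) _ (complexBetti.map (fiberι g t) (2 * n) x)) = _
    rw [map_complexGysin_fiberι_eq_of_endo hg t θ hθ θt hθt, htop, map_smul]
    rfl
  -- `θ_* 1 = c' • 1`
  obtain ⟨c', hc'⟩ := eq_smul_one_of_degree_zero hZ (complexGysin complexOrientationFamily hZ hZ θ
    (rfl : 0 + 2 * (n + 1) = 0 + 2 * (n + 1)) (singularCohomology.one ℂ (ComplexPoints 𝒵)))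
  rw [hc']
  -- pair with `ω`
  have h0 : 0 + 2 * (n + 1) = 2 * (n + 1) := by ring
  have hpair : cupPairing (complexOrientationFamily hZ) h0 (c' • singularCohomology.one ℂ (ComplexPoints 𝒵)) ω =
      cupPairing (complexOrientationFamily hZ) h0 (c • singularCohomology.one ℂ (ComplexPoints 𝒵)) ω := by
    rw [← hc', cupPairing_complexGysin_complexOrientationFamily θ hZ hZ rfl h0 h0, hθω, map_smul, map_smul, LinearMap.smul_apply]
  -- `⟨1, ω⟩ ≠ 0` (else `ω ⊥ H⁰ = ℂ · 1`, contradicting `ω ≠ 0`), so `c' = c`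
  have hne : cupPairing (complexOrientationFamily hZ) h0 (singularCohomology.one ℂ (ComplexPoints 𝒵)) ω ≠ 0 := by
    intro h1
    apply hx
    have h0' : 2 * (n + 1) + 0 = 2 * (n + 1) := by ring
    refine eq_zero_of_forall_cupPairing_eq_zero complexOrientationFamily hZ h0' fun u ↦ ?_
    obtain ⟨a, rfl⟩ := eq_smul_one_of_degree_zero hZ u
    have hflip := congrArg (fun φ ↦ φ ω (a • singularCohomology.one ℂ (ComplexPoints 𝒵)))
      (cupPairing_flip (cupProduct_gradedComm_holds ℂ (ComplexPoints 𝒵)) (complexOrientationFamily hZ) h0 h0')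
    simp only [LinearMap.flip_apply, zero_mul, pow_zero, one_smul] at hflip
    rw [← hflip, map_smul, LinearMap.smul_apply, h1, smul_zero]
  have hcc : (c' - c) • cupPairing (complexOrientationFamily hZ) h0 (singularCohomology.one ℂ (ComplexPoints 𝒵)) ω = 0 := by
    rw [map_smul, map_smul, LinearMap.smul_apply, LinearMap.smul_apply] at hpair
    rw [sub_smul, hpair, sub_self]
  rw [sub_eq_zero.1 ((smul_eq_zero.1 hcc).resolve_right hne)]

/-- **`q · θ_* D = θ_* 1 ∪ D`-type identity: if `θ^* D = q D` then `q · θ_* D = D ∪ θ_* 1`** (projection formula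
`θ_*(θ^* D ∪ 1) = D ∪ θ_* 1`). [cite: FultonYoungTableaux1997, Appendix B §B.1 (6)] -/
theorem smul_gysin_eq_of_map_eq_smul {m : ℕ} (hZ : IsSmoothProjective m 𝒵) (θ : 𝒵 ⟶ 𝒵) {k : ℕ} (D : complexBetti 𝒵 k) {q : ℂ}
    (hD : complexBetti.map θ k D = q • D) :
    q • complexGysin complexOrientationFamily hZ hZ θ (rfl : k + 2 * m = k + 2 * m) D =
      cupProduct (Nat.add_zero k) D (complexGysin complexOrientationFamily hZ hZ θ (rfl : 0 + 2 * m = 0 + 2 * m)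
        (singularCohomology.one ℂ (ComplexPoints 𝒵))) := by
  have h := complexGysin_cup (μ := complexOrientationFamily) hasPoincareDuality_complexOrientationFamily hZ hZ θ
    (Nat.add_zero k) (rfl : k + 2 * m = k + 2 * m) (rfl : 0 + 2 * m = 0 + 2 * m) (Nat.add_zero k) D
    (singularCohomology.one ℂ (ComplexPoints 𝒵))
  rw [hD, LinearMap.map_smul₂, cupProduct_one, map_smul] at h
  exact h

/-- **`θ^* D = q D` and `θ_* 1 = c · 1` give `q · θ_* D = c · D`.** [cite: FultonYoungTableaux1997, Appendix B §B.1 (6)] -/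
theorem smul_gysin_eq_smul_of_map_eq_smul {m : ℕ} (hZ : IsSmoothProjective m 𝒵) (θ : 𝒵 ⟶ 𝒵) {k : ℕ} (D : complexBetti 𝒵 k) {q c : ℂ}
    (hD : complexBetti.map θ k D = q • D)
    (hdeg : complexGysin complexOrientationFamily hZ hZ θ (rfl : 0 + 2 * m = 0 + 2 * m) (singularCohomology.one ℂ (ComplexPoints 𝒵)) =
      c • singularCohomology.one ℂ (ComplexPoints 𝒵)) :
    q • complexGysin complexOrientationFamily hZ hZ θ (rfl : k + 2 * m = k + 2 * m) D = c • D := by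
  rw [smul_gysin_eq_of_map_eq_smul hZ θ D hD, hdeg, map_smul, cupProduct_one]

/-- **From pull-back weight to push-forward weight: `θ^* D = Nᵘ D`, `θ_* 1 = N^{w} · 1`, `u ≤ w` ⟹ `θ_* D = N^{w-u} D`.**
[cite: FultonYoungTableaux1997, Appendix B §B.1 (6)] [cite: Kleiman1968AlgebraicCycles, §1.3 (p. 374)] -/
theorem gysin_eq_smul_of_map_eq_smul {m : ℕ} (hZ : IsSmoothProjective m 𝒵) (θ : 𝒵 ⟶ 𝒵) {k : ℕ} (D : complexBetti 𝒵 k) {N u w : ℕ}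
    (hN : 2 ≤ N) (huw : u ≤ w) (hD : complexBetti.map θ k D = ((N : ℂ) ^ u) • D)
    (hdeg : complexGysin complexOrientationFamily hZ hZ θ (rfl : 0 + 2 * m = 0 + 2 * m) (singularCohomology.one ℂ (ComplexPoints 𝒵)) =
      ((N : ℂ) ^ w) • singularCohomology.one ℂ (ComplexPoints 𝒵)) :
    complexGysin complexOrientationFamily hZ hZ θ (rfl : k + 2 * m = k + 2 * m) D = ((N : ℂ) ^ (w - u)) • D := by
  have h := smul_gysin_eq_smul_of_map_eq_smul hZ θ D hD hdeg
  have hne : (N : ℂ) ^ u ≠ 0 := pow_ne_zero _ (by exact_mod_cast (show N ≠ 0 by omega))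
  refine smul_right_injective _ hne ?_
  change ((N : ℂ) ^ u) • _ = ((N : ℂ) ^ u) • _
  rw [h, smul_smul, ← pow_add, show u + (w - u) = w by omega]

end Degrees

section SquareDegrees

variable {𝒳 S : SchemeOver ℂ} {d : ℕ} {f : 𝒳 ⟶ S}

/-- `𝒴` — the fibre square `𝒳 ×_S 𝒳` (display notation for the tree's `familyPullback f f`). -/
local notation3 (prettyPrint := false) "𝒴[" f "]" => familyPullback f f
/-- `𝐚` — the first projection `𝒳 ×_S 𝒳 ⟶ 𝒳`. -/
local notation3 (prettyPrint := false) "𝐚[" f "]" => familyPullback.fst f f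
/-- `𝐛` — the second projection `𝒳 ×_S 𝒳 ⟶ 𝒳` (the pencil structure of the square is `𝐛 ≫ f`). -/
local notation3 (prettyPrint := false) "𝐛[" f "]" => familyPullback.snd f f

variable {X : SchemeOver ℂ} {m₀ : ℕ}

/-- **`φ × 1` acts as `N^{2 dim X}` on the top degree `H^{2(dim X + dim X)}((X × X)(ℂ); ℂ)`** (part XXXVII-b's `map_whiskerRight_top`
in the degree spelling `2 (m₀ + m₀)` of the square pencil). [cite: HatcherAT2002, §3.2 Thm. 3.15, §3.3 Thm. 3.26] [cite: MumfordAV1970, §19] -/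
theorem map_whiskerRight_top' (hX : IsSmoothProjective m₀ X) (φ : X ⟶ X) (N : ℕ)
    (hφ : ∀ (u : ℕ) (x : complexBetti X u), complexBetti.map φ u x = ((N : ℂ) ^ u) • x) (w : complexBetti (X ⊗ X) (2 * (m₀ + m₀))) :
    complexBetti.map (φ ▷ X) (2 * (m₀ + m₀)) w = ((N : ℂ) ^ (2 * m₀)) • w := by
  have hspan := kunnethSpan_complexBetti hX hX (2 * (m₀ + m₀)) w
  refine Submodule.span_induction (p := fun w _ ↦ complexBetti.map (φ ▷ X) (2 * (m₀ + m₀)) w = ((N : ℂ) ^ (2 * m₀)) • w)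
    ?_ ?_ ?_ ?_ hspan
  · rintro _ ⟨i, j, h, x, y, rfl⟩
    by_cases hi : i = 2 * m₀
    · subst hi
      rw [map_whiskerRight_cross φ h x y, hφ, map_smul, LinearMap.map_smul₂]
    · rcases Nat.lt_or_gt_of_ne hi with hlt | hgt
      · haveI := subsingleton_complexBetti hX (show 2 * m₀ < j by omega)
        rw [Subsingleton.elim y 0]
        simp only [map_zero, smul_zero]
      · haveI := subsingleton_complexBetti hX (show 2 * m₀ < i by omega)
        rw [Subsingleton.elim x 0]
        simp only [map_zero, LinearMap.zero_apply, smul_zero]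
  · rw [map_zero, smul_zero]
  · intro x y _ _ hx hy
    rw [map_add, hx, hy, smul_add]
  · intro c x _ hx
    rw [map_smul, hx, smul_comm]

/-- **`1 × φ` acts as `N^{2 dim X}` on the top degree, spelling `2 (m₀ + m₀)`.** [cite: HatcherAT2002, §3.2 Thm. 3.15] [cite: MumfordAV1970, §19] -/
theorem map_whiskerLeft_top' (hX : IsSmoothProjective m₀ X) (φ : X ⟶ X) (N : ℕ)
    (hφ : ∀ (u : ℕ) (x : complexBetti X u), complexBetti.map φ u x = ((N : ℂ) ^ u) • x) (w : complexBetti (X ⊗ X) (2 * (m₀ + m₀))) :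
    complexBetti.map (X ◁ φ) (2 * (m₀ + m₀)) w = ((N : ℂ) ^ (2 * m₀)) • w := by
  have hspan := kunnethSpan_complexBetti hX hX (2 * (m₀ + m₀)) w
  refine Submodule.span_induction (p := fun w _ ↦ complexBetti.map (X ◁ φ) (2 * (m₀ + m₀)) w = ((N : ℂ) ^ (2 * m₀)) • w)
    ?_ ?_ ?_ ?_ hspan
  · rintro _ ⟨i, j, h, x, y, rfl⟩
    by_cases hj : j = 2 * m₀
    · subst hj
      rw [map_whiskerLeft_cross φ h x y, hφ, map_smul, map_smul]
    · rcases Nat.lt_or_gt_of_ne hj with hlt | hgt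
      · haveI := subsingleton_complexBetti hX (show 2 * m₀ < i by omega)
        rw [Subsingleton.elim x 0]
        simp only [map_zero, LinearMap.zero_apply, smul_zero]
      · haveI := subsingleton_complexBetti hX (show 2 * m₀ < j by omega)
        rw [Subsingleton.elim y 0]
        simp only [map_zero, smul_zero]
  · rw [map_zero, smul_zero]
  · intro x y _ _ hx hy
    rw [map_add, hx, hy, smul_add]
  · intro c x _ hx
    rw [map_smul, hx, smul_comm]

/-- **`θ_{1*} 1 = N^{2d} · 1` ON THE FIBRE SQUARE**: the restriction of `θ₁ = ν ×_S 1` to `Y_t ≅ X_t × X_t` is `ν_t × 1` (part XXXVII-b),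
which acts as `N^{2d}` on the top class of `X_t × X_t`; §1. [cite: Fulton1998, Example 1.7.4] [cite: MumfordAV1970, §19] -/
theorem gysin_squareEndo_fst_one (hf : IsCompactAbelianPencil f d) (t : ComplexPoints S) (ν : 𝒳 ⟶ 𝒳) (N : ℕ)
    (hθt : ∃ (νs : fiberOver f t ⟶ fiberOver f t) (A : AbelianVariety ℂ) (e : A.X ≅ fiberOver f t),
      νs ≫ fiberι f t = fiberι f t ≫ ν ∧ e.hom ≫ νs = (N • 𝟙 A).hom.hom.hom ≫ e.hom)
    {θ₁ : 𝒴[f] ⟶ 𝒴[f]} (h1a : θ₁ ≫ 𝐚[f] = 𝐚[f] ≫ ν) (h1b : θ₁ ≫ 𝐛[f] = 𝐛[f]) :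
    complexGysin complexOrientationFamily (isCompactAbelianPencil_square hf rfl).isSmoothProjective_total
      (isCompactAbelianPencil_square hf rfl).isSmoothProjective_total θ₁ (rfl : 0 + 2 * (d + d + 1) = 0 + 2 * (d + d + 1))
      (singularCohomology.one ℂ (ComplexPoints 𝒴[f])) = ((N : ℂ) ^ (2 * d)) • singularCohomology.one ℂ (ComplexPoints 𝒴[f]) := by
  haveI : IsSeparated S.hom := hf.isSmoothProjective_base.isProjectiveOver.isProper.toIsSeparated
  have hg := isCompactAbelianPencil_square hf rfl
  have hθ₁g : θ₁ ≫ (𝐛[f] ≫ f) = 𝐛[f] ≫ f := by rw [← Category.assoc, h1b]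
  obtain ⟨νt, A, e, hνt, he⟩ := hθt
  obtain ⟨E, hEa, hEb⟩ := exists_fiberOver_familyPullback_iso f f t
  obtain ⟨θ1t, hθ1t⟩ := exists_fiberEndo_restrict θ₁ hθ₁g t
  have c1 := squareEndo_fst_chart t ν h1a h1b E hEa hEb νt hνt θ1t hθ1t
  refine gysin_one_eq_smul_of_fibre_top hg t θ₁ hθ₁g θ1t hθ1t _ fun ω ↦ ?_
  -- transport `(ν_t × 1)^* = N^{2d}` on the top class along `E`
  have hinj : Function.Injective (complexBetti.map E.hom (2 * (d + d))) := by
    intro y y' hyy'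
    have h := congrArg (complexBetti.map E.inv (2 * (d + d))) hyy'
    rwa [← complexBetti.map_comp_apply', ← complexBetti.map_comp_apply', E.inv_hom_id, complexBetti.map_id,
      ModuleCat.id_apply, ModuleCat.id_apply] at h
  apply hinj
  rw [← complexBetti.map_comp_apply', c1, complexBetti.map_comp_apply', map_smul]
  exact map_whiskerRight_top' (hf.isSmoothProjective_fiberOver t) νt N (fun u x ↦ map_fiberEndo_eq_smul_of_chart t νt A e N he u x) _

/-- **`θ_{2*} 1 = N^{2d} · 1` ON THE FIBRE SQUARE** (restriction `1 × ν_t`). [cite: Fulton1998, Example 1.7.4] [cite: MumfordAV1970, §19] -/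
theorem gysin_squareEndo_snd_one (hf : IsCompactAbelianPencil f d) (t : ComplexPoints S) (ν : 𝒳 ⟶ 𝒳) (hν : ν ≫ f = f) (N : ℕ)
    (hθt : ∃ (νs : fiberOver f t ⟶ fiberOver f t) (A : AbelianVariety ℂ) (e : A.X ≅ fiberOver f t),
      νs ≫ fiberι f t = fiberι f t ≫ ν ∧ e.hom ≫ νs = (N • 𝟙 A).hom.hom.hom ≫ e.hom)
    {θ₂ : 𝒴[f] ⟶ 𝒴[f]} (h2a : θ₂ ≫ 𝐚[f] = 𝐚[f]) (h2b : θ₂ ≫ 𝐛[f] = 𝐛[f] ≫ ν) :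
    complexGysin complexOrientationFamily (isCompactAbelianPencil_square hf rfl).isSmoothProjective_total
      (isCompactAbelianPencil_square hf rfl).isSmoothProjective_total θ₂ (rfl : 0 + 2 * (d + d + 1) = 0 + 2 * (d + d + 1))
      (singularCohomology.one ℂ (ComplexPoints 𝒴[f])) = ((N : ℂ) ^ (2 * d)) • singularCohomology.one ℂ (ComplexPoints 𝒴[f]) := by
  haveI : IsSeparated S.hom := hf.isSmoothProjective_base.isProjectiveOver.isProper.toIsSeparated
  have hg := isCompactAbelianPencil_square hf rfl
  have hθ₂g : θ₂ ≫ (𝐛[f] ≫ f) = 𝐛[f] ≫ f := squareEndo_comp_eq hν h2b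
  obtain ⟨νt, A, e, hνt, he⟩ := hθt
  obtain ⟨E, hEa, hEb⟩ := exists_fiberOver_familyPullback_iso f f t
  obtain ⟨θ2t, hθ2t⟩ := exists_fiberEndo_restrict θ₂ hθ₂g t
  have c2 := squareEndo_snd_chart t ν h2a h2b E hEa hEb νt hνt θ2t hθ2t
  refine gysin_one_eq_smul_of_fibre_top hg t θ₂ hθ₂g θ2t hθ2t _ fun ω ↦ ?_
  have hinj : Function.Injective (complexBetti.map E.hom (2 * (d + d))) := by
    intro y y' hyy'
    have h := congrArg (complexBetti.map E.inv (2 * (d + d))) hyy'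
    rwa [← complexBetti.map_comp_apply', ← complexBetti.map_comp_apply', E.inv_hom_id, complexBetti.map_id,
      ModuleCat.id_apply, ModuleCat.id_apply] at h
  apply hinj
  rw [← complexBetti.map_comp_apply', c2, complexBetti.map_comp_apply', map_smul]
  exact map_whiskerLeft_top' (hf.isSmoothProjective_fiberOver t) νt N (fun u x ↦ map_fiberEndo_eq_smul_of_chart t νt A e N he u x) _

end SquareDegrees

end Summit.HodgeConjecture.HodgeConjecture.Ring2.AbelianAll

end
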